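import Summits.ValiantsHypothesis.ValiantsHypothesis.Theorems.KPlusLogSqLawLiftingRungFourRange
import Summits.ValiantsHypothesis.ValiantsHypothesis.Theorems.KPlusLogSqLawTropicalGradedWalkChainTwo

/-!
# Route «KPlusLogSqLaw», crux `Lifting` / `WeakLifting` — the `K = 4` LIFT rung on the range `m ≤ 18000`
# (Descartes + the kernel GRW-lite floor)

HONEST FRAMING.  Helper (partial range, no stub credit) toward the lifting cruxes of route `KPlusLogSqLaw`
(`Summit.ValiantsHypothesis.ValiantsHypothesis.Theses.KPlusLogSqLaw.Lifting`, item `stmt-ValiantsHypothesis-19772`, which implies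
`…KPlusLogSqLaw.WeakLifting`, item `stmt-ValiantsHypothesis-19561`, by `TropicalCensus.weakLifting_of_tropicalLifting`); cell
`pub-symmetroid`, seat val-sym-lift-p3 g20, 2026-08-29.  The tree's `lift_rung_four_of_le` (p427828, this seat's g0) proves the `K = 4`
rung `TropRootLawAt m 4 n → RealRootLawAt m 4 (2^12 (n+1))` on the range `m + 3 ≤ 3072` from the QUADRATIC tropical floor of leading
coefficient `1/2` (`T(m,4) ≥ T(m,3) ≥ C(m+2,2) − 2`, SHIFT-THREE).  Since then the tropical row `(m,4)` received a kernel floor of leading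
coefficient `3/2` — the GRW-lite family of seat val-sym-trop-p3 (`TropicalCensus.grw2_le_of_tropRootLawAt_four`, p690095:
`TropRootLawAt m 4 B → (3m² − 3m)/2 − 1 ≤ B` for `m ≥ 1`).  Plugging it into the same two-line Descartes argument
(`Census.realRootLawAt_descartes`: `ζ_tot(m,4) ≤ 2·C(m+3,3) − 1`, cubic) extends the range of the rung by a factor `≈ 6`:

* `lift_rung_four_of_le_grw : m ≤ 18000 → TropRootLawAt m 4 n → RealRootLawAt m 4 (2 ^ (3 * 4) * (n + 1))`

(arithmetic: `(m+1)(m+2)(m+3) ≤ 18432·m(m−1)` on `44 ≤ m ≤ 18000`; the exact edge of this argument is `m = 18425`; below `m = 3070`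
the tree's rung is used verbatim).  WHAT THIS IS NOT: the rung for ALL `m` at `K = 4` needs a CUBIC tropical `(m,4)` family or a
sub-Descartes real bound — the cell's open `K = 4` fork (EXPONENT(4)); the located GRW family (`2m² + 1`, kernel to `m = 11`) would only
move the edge to `m ≈ 24500`.  Nothing here asserts `Lifting`, `WeakLifting`, `TropicalB`, `KPlusLogSqLaw`, `MatrixDescartes` or
anything about `VP ≠ VNP`.  Def-free. [folklore] Descartes' rule + arithmetic.
-/

set_option linter.dupNamespace false
set_option autoImplicit false

namespace Summit.ValiantsHypothesis.ValiantsHypothesis.Theorems.KPlusLogSqLaw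

open Summit.ValiantsHypothesis.ValiantsHypothesis.Theorems.LacunarySymmetroidMatrixDescartes (RealRootLawAt)
open Summit.ValiantsHypothesis.ValiantsHypothesis.Theorems.LacunarySymmetroidMatrixDescartes.TropicalCensus (TropRootLawAt)

/-- the cubic-versus-quadratic arithmetic of the range: `(k+2)(k+3)(k+4) ≤ 18432·(k+1)·k` for `43 ≤ k ≤ 17999`
(i.e. `(m+1)(m+2)(m+3) ≤ 18432·m(m−1)` for `m = k + 1`). [folklore] -/
theorem range_arith_grw (k : ℕ) (h43 : 43 ≤ k) (hk : k ≤ 17999) :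
    (k + 2) * (k + 3) * (k + 4) ≤ 18432 * ((k + 1) * k) := by
  nlinarith [Nat.mul_le_mul hk (le_refl ((k + 1) * (k + 1))), Nat.mul_le_mul h43 (le_refl (k + 1))]

/-- `2·((3k² + 3k)/2) = 3k² + 3k` (the GRW-lite count is an integer). [folklore] -/
theorem two_mul_grw_half (k : ℕ) : 2 * ((3 * k ^ 2 + 3 * k) / 2) = 3 * k ^ 2 + 3 * k := by
  have he : Even (3 * k ^ 2 + 3 * k) := by
    have h1 : 3 * k ^ 2 + 3 * k = 3 * (k * (k + 1)) := by ring
    rw [h1]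
    exact (Nat.even_mul_succ_self k).mul_left 3
  obtain ⟨r, hr⟩ := he
  omega

/-- **LIFT, rung `K = 4`, on the range `m ≤ 18000` (constant `2^12`):** there the kernel GRW-lite tropical floor
`(3m² − 3m)/2 − 1 ≤ n` (`grw2_le_of_tropRootLawAt_four`) and the cubic real Descartes ceiling `2·C(m+3,3) − 1` fit under
`2^12·(n+1)`; below `m = 3070` this is the tree's `lift_rung_four_of_le`. [folklore] -/
theorem lift_rung_four_of_le_grw (m n : ℕ) (hm : m ≤ 18000) (h : TropRootLawAt m 4 n) :
    RealRootLawAt m 4 (2 ^ (3 * 4) * (n + 1)) := by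
  by_cases hsmall : m + 3 ≤ 3072
  · exact lift_rung_four_of_le m n hsmall h
  have h1 := LacunarySymmetroidMatrixDescartes.TropicalCensus.grw2_le_of_tropRootLawAt_four m n (by omega) h
  refine LacunarySymmetroidMatrixDescartes.Census.realRootLawAt_mono ?_
    (LacunarySymmetroidMatrixDescartes.Census.realRootLawAt_descartes m 4 (by norm_num))
  obtain ⟨k, rfl⟩ : ∃ k, m = k + 1 := ⟨m - 1, by omega⟩
  have h43 : 43 ≤ k := by omega
  have hk : k ≤ 17999 := by omega
  have h2 : Nat.choose (k + 1 + 4 - 1) (k + 1) = Nat.choose (k + 4) 3 := by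
    rw [show k + 1 + 4 - 1 = (k + 1) + 3 from rfl]
    exact Nat.choose_symm_add
  -- `6·C(k+4,3) = (k+2)(k+3)(k+4)`
  have h3 := three_mul_choose_three (k + 1)
  have h4 : 2 * (k + 3).choose 2 = (k + 3) * (k + 2) := by
    have := Nat.add_one_mul_choose_eq (k + 2) 1
    rw [Nat.choose_one_right] at this
    simpa [mul_comm] using this.symm
  have h8 : 6 * (k + 4).choose 3 = (k + 2) * (k + 3) * (k + 4) := by
    have h3' : 3 * (k + 4).choose 3 = (k + 4) * (k + 3).choose 2 := h3
    nlinarith [h3', h4]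
  -- the tropical floor in terms of `k`: `(3(k+1)² − 3(k+1))/2 = (3k² + 3k)/2`
  have h6 : 3 * (k + 1) ^ 2 - 3 * (k + 1) = 3 * k ^ 2 + 3 * k := by
    have : 3 * (k + 1) ^ 2 = 3 * k ^ 2 + 3 * k + 3 * (k + 1) := by ring
    omega
  rw [h6] at h1
  have h7 := two_mul_grw_half k
  have h5 := range_arith_grw k h43 hk
  rw [h2, show 2 ^ (3 * 4) = 4096 by norm_num]
  -- `2·C ≤ 4096(n+1) + 1`: from `6C = (k+2)(k+3)(k+4) ≤ 18432 k(k+1) = 12288·(3k²+3k)/... ` and `(3k²+3k)/2 ≤ n + 1`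
  have h9 : (3 * k ^ 2 + 3 * k) / 2 ≤ n + 1 := by omega
  have h10 : 18432 * ((k + 1) * k) = 6144 * (2 * ((3 * k ^ 2 + 3 * k) / 2)) := by
    rw [h7]; ring
  have h11 : 6 * (k + 4).choose 3 ≤ 6144 * (2 * (n + 1)) := by
    calc 6 * (k + 4).choose 3 = (k + 2) * (k + 3) * (k + 4) := h8
      _ ≤ 18432 * ((k + 1) * k) := h5
      _ = 6144 * (2 * ((3 * k ^ 2 + 3 * k) / 2)) := h10
      _ ≤ 6144 * (2 * (n + 1)) := Nat.mul_le_mul_left _ (Nat.mul_le_mul_left _ h9)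
  omega

end Summit.ValiantsHypothesis.ValiantsHypothesis.Theorems.KPlusLogSqLaw
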